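/-
Copyright (c) 2026 the pub-hodgecm-mathlib formalisation cell (harness21).  Prover seat hodgecm-mathlib-LD1-p01 (g5), ROAD O («orthogonal copy»)
of line LD — the PIN ASSEMBLY part 1 (the LINE half), 2026-09-02.  THEOREMS ONLY (no definition, no named fact, no `sorry`, no instance, no notation).
`--supports stmt-HodgeConjecture-24832 --as helper`.
-/
import Summits.HodgeConjecture.HodgeConjecture.Theorems.F0LD1MeetsOfOrthogonalCopy
import Summits.HodgeConjecture.HodgeConjecture.Theorems.F0LD1UnitaryEquivTransport
import Summits.HodgeConjecture.HodgeConjecture.Theorems.F0LD2ArchSignOfTorusCovariant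
import Summits.HodgeConjecture.HodgeConjecture.Theorems.F0LD2ThetaFinComponentOfArchCentre
import Summits.HodgeConjecture.HodgeConjecture.Theorems.F0LD2CurveHolCotFormsArchCentre
import Summits.HodgeConjecture.HodgeConjecture.Theorems.F0LD2CurveHolTestVector
import Summits.HodgeConjecture.HodgeConjecture.Theorems.F0LD2SameLabelClassesOfAFUCompact
import Summits.HodgeConjecture.HodgeConjecture.Theorems.F0P6LD1ThetaCharacterPin
import Summits.HodgeConjecture.HodgeConjecture.Theorems.F0P6LD1TransportRational
import Summits.HodgeConjecture.HodgeConjecture.Theorems.F0LD1RelativeArchPositivity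
import Summits.HodgeConjecture.HodgeConjecture.Theorems.F0LD2ArchTypeAway
import Literature.NumberTheory.Automorphic.UnitaryGroupDiscreteRepCentralCharacter
import HarnessLib

-- As in the lineage: statements over the theta-kernel datum elaborate to very large types; elaborate sequentially.
set_option Elab.async false

/-!
# Crux `HLiu418`, line LD, ROAD O — the LINE HALF of the unitary-class pin: for a hol₂ `P` with the θ-type finite component `σ` and two non-zero closed theta spans
# `Q̄(a′, ξ′)`, `Q̄(b, ξ″)` unitarily equivalent to `P`, the lines agree: `locF a′ = locF b` at every finite place and `a′ b⁻¹` is totally positive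

Cell hodgecm-mathlib (D-0151), FLOOR 0; crux item `HLiu418` = stmt-HodgeConjecture-24832; LD leaves ED. 10 (`stub_letter_B6`).  Seat LD1-p01 (g5); chair LD1-plan (g3)
HANDS v3–v6; memo `F0/P6/LD/LD1-p01/g5/ROAD-O-orthogonal-copy.v1.LD1-p01g5.md`; LD-ref1 BOX ROAD-O #1–#5, PIN-WATCH #1.  THEOREMS ONLY; `--supports stmt-HodgeConjecture-24832`.
Part 1 of the PIN ASSEMBLY (part 2: `F0LD1ThetaSpanPinOfBricks`, which adds line transport, organ (I) and the character pin and concludes ★ `F0LD1ThetaSpanPinDefs.ThetaSpanPin₂`).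

`spanLinePin_of_bricks (hR) (hAwayU)`: over the binders of ★ `F0LD1ThetaSpanPinDefs.ThetaSpanPin₂` (organ-(R) prefix, cone frame `𝔣`, `λ`, the θ-type `σ ↪ ω(λ,ε_a,χ)_f ∘ congr⁻¹`,
pinned `ιA`, hol₂ `P` with `P.HasFinComponent σ`, lines `a′ b`, characters `ξ′ ξ″`, closed theta spans `Q′ = Q̄(a′,ξ′) ≠ ⊥`, `Q″ = Q̄(b,ξ″)`, `P ≃ᵤ Q′`, `P ≃ᵤ Q″`) concludes
`(∀ v, locF a′ v = locF b v) ∧ (∀ ρ, 0 < ρ(a′ b⁻¹))`.  INPUTS: `hR` = letter R₂ `LemD1_4SameLabelNonsplitCM₂` (★ in-house via LTC₁ ∕ (Z-van)); `hAwayU` = the archimedean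
signs AWAY from `ι` in unitary-class currency («hol₂ `P`, discrete `P₁ ≃ᵤ P` meeting `a₁` ⇒ ★ `archTypeAway₂_holds`' conclusion at every `τ′ ≠ ι` for `a₁`», = brick (β-away)
`archTypeAway₂_of_invariant` (LD1-p02) + door `kcInvariant_of_areUnitarilyEquivalent` (LD2-p02)).
ROUTE: the spans are irreducible (`≃ᵤ P`, ★ `isTopIrreducible_congr`) and MEET their own lines (a non-zero generator, §0); the central character `ψ` of `P` rides `≃ᵤ`
(★ (T2) `centralCharacter_transport₂`) and is trivial on the archimedean centre (★ `centralCharacter_archCentre_eq_one₂` at a hol test vector), so ★ (δ)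
`thetaFinComponent₂_of_archCentre_fixed` gives θ-type finite components `ω(λ,ε_{a′},χ′)_f`, `ω(λ,ε_b,χ″)_f` of the spans, transferred to `P` (★ glue §1 `hasFinComponent_of_equiv`);
★ `sameLabelClasses₂_of_sameLabel hR` on `P` twice ⇒ `locF a′ = locF a = locF b`; at `ι` ★ (β) `im_mul_im_pos_of_meets_of_torusCovariant` with the covariant vectors of ★
`torusCovariant_of_isHolCotangentAt₂ P` pushed through `≃ᵤ` (★ (T1d)); away from `ι` `hAwayU`; the two signs combine as in ★ `F0LD1RelativeArchPositivity` §2.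

HONEST LABEL: HC_CM is proved only modulo the 7 printed citations (2 remaining: hLiu418 = stmt-HodgeConjecture-24832, h413 = stmt-HodgeConjecture-24833)
until rung 0 closes; (B6) is BYPASSED for hol `P` only; this file discharges nothing printed.

## References
* [Liu2021] Y. Liu, Camb. J. Math. 9 (2021) = arXiv:2102.11518: App. B Thm. B.4 (2) (p. 98), proof of Cor. B.6 (3) (p. 99 L41–67); App. D Lem. D.1 (3)(4), D.2 (1)(3),
  proof of Prop. D.4 (1) (p. 131).
* [HarrisKudlaSweet1996] M. Harris, S. Kudla, W. J. Sweet, JAMS 9 (1996), Thm. 6.1.  [DeitmarEchterhoff2014] A. Deitmar, S. Echterhoff, 2nd ed., Cor. 6.1.9, Lemma 6.1.7.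
* [BorelJacquet1979] A. Borel, H. Jacquet, PSPM 33.1, §4.6.
-/


set_option autoImplicit false
-- the mandated namespace has the single-problem summit's repeated segment (`HodgeConjecture.HodgeConjecture`)
set_option linter.dupNamespace false

noncomputable section

open NumberField NumberField.InfinitePlace MeasureTheory IsDedekindDomain
open scoped Matrix ComplexOrder ENNReal InnerProductSpace

namespace Summit.HodgeConjecture.HodgeConjecture.Cruxes.HLiu418.F0LD1ThetaSpanLinePinOfBricks

open _root_.MeasureTheory
open Literature.NumberTheory.Automorphic Literature.NumberTheory.Automorphic.UnitaryGroup
open Literature.NumberTheory.Automorphic.UnitaryGroup.CotangentForms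
open Literature.NumberTheory.Automorphic.UnitaryCurveForms
open Literature.NumberTheory.Automorphic.IdeleClassGroup
open Literature.NumberTheory.Automorphic.Liu2021
open Literature.NumberTheory.Automorphic.Liu2021.Def411WeilCarriers
open Literature.NumberTheory.Automorphic.Liu2021.Def411WeilCarriersDoubling
open Literature.NumberTheory.Automorphic.Liu2021.LemD1RankTwoCMLetters
open Literature.NumberTheory.GaloisRepresentations
open Literature.NumberTheory.GelbartRogawski1991 Literature.NumberTheory.GelbartRogawski1991.UnitaryDualPair
open Literature.NumberTheory.Weil1964
open Literature.RepresentationTheory.Liu2021 Literature.RepresentationTheory.HarrisKudlaSweet1996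
open Literature.RepresentationTheory.CompactGroups
open Literature.AlgebraicGeometry.ShimuraVarieties
open Literature.NumberTheory.Rogawski1990
open Summit.HodgeConjecture.HodgeConjecture.Cruxes.HLiu418.F0LD1ThetaTransportKit
open Summit.HodgeConjecture.HodgeConjecture.Cruxes.HLiu418.F0LD2FrameTransportPin
open Summit.HodgeConjecture.HodgeConjecture.Cruxes.HLiu418.F0LD1CharThetaSpaceLeOfIrreducible

/-! ## §0 A non-zero closed span has a non-zero generator -/

/-- If a submodule's carrier is the closure of the span of `S` and the submodule is non-zero, some element of `S` is non-zero. [folklore] -/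
theorem exists_mem_ne_zero_of_closure_span {E : Type*} [NormedAddCommGroup E] [NormedSpace ℂ E] {S : Set E} {Q : Submodule ℂ E}
    (hQ : (Q : Set E) = closure ((Submodule.span ℂ S : Submodule ℂ E) : Set E)) (hne : Q ≠ ⊥) : ∃ v ∈ S, v ≠ 0 := by
  by_contra h
  push Not at h
  apply hne
  have hS : Submodule.span ℂ S = ⊥ := Submodule.span_eq_bot.2 h
  rw [Submodule.eq_bot_iff]
  intro x hx
  have hx' : x ∈ closure ((Submodule.span ℂ S : Submodule ℂ E) : Set E) := by rw [← hQ]; exact hx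
  rw [hS, Submodule.bot_coe, closure_singleton] at hx'
  exact hx'

/-! ## §1 The line half of the pin -/

set_option maxHeartbeats 6400000 in
-- (statement size: two organ-sized hypotheses and the organ-sized binder prefix; every step is a named ★ lemma)
/-- **THE LINE HALF OF THE UNITARY-CLASS PIN** (module docstring): for the `ThetaSpanPin₂` data, `(∀ v, locF a′ v = locF b v) ∧ (∀ ρ, 0 < ρ(a′ b⁻¹))`.
[cite: Liu2021, App. B Thm. B.4 (2) (p. 98); proof of Cor. B.6 (3) (p. 99 L41–46); App. D Lem. D.1 (4), D.2 (1)(3); proof of Prop. D.4 (1) (p. 131 L27–34)]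
[cite: HarrisKudlaSweet1996, Thm. 6.1] [cite: DeitmarEchterhoff2014, Cor. 6.1.9] -/
theorem spanLinePin_of_bricks (hR : LemD1_4SameLabelNonsplitCM₂)
    (hAwayU : ∀ (L : Type) [Field L] [NumberField L] [IsCMField L] (ι : L →+* ℂ) (H : Matrix (Fin 2) (Fin 2) L)
        (dV : Fin 2 → L) (hdV : ∀ i, IsCMField.complexConj L (dV i) = dV i) (hdV0 : ∀ i, dV i ≠ 0)
        (t : L) (ht : t ≠ 0) (g : GL (Fin 2) L)
        (hg : formCongr ((IsCMField.complexConj L : L ≃ₐ[↥(maximalRealSubfield L)] L) : L →+* L) g (t • H) = Matrix.diagonal dV),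
        (∃ T : GL (Fin 2) ℂ, formCongr (starRingEnd ℂ) T ((Matrix.diagonal dV).map ι) = Matrix.diagonal ![(1 : ℂ), -1]) →
        (∀ τ' : L →+* ℂ, InfinitePlace.mk τ' ≠ InfinitePlace.mk ι → ((Matrix.diagonal dV).map τ').PosDef) →
        4 ≤ Module.finrank ℚ L →
        ∀ (𝔣 : ConeFrame L H (cmPlace L ι))
          (μ : Measure (adelicGroupData (↥(maximalRealSubfield L)) L (IsCMField.complexConj L) 2 H).automorphicQuotient)
          [(adelicGroupData (↥(maximalRealSubfield L)) L (IsCMField.complexConj L) 2 H).IsAutomorphicMeasure μ]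
          {n' : ℕ} (e₁ : Fin 2 × Fin 1 ≃ Fin n')
          (lam : Literature.NumberTheory.Automorphic.IdeleClassGroup L →ₜ* Circle) (hlam : IsConjugateSymplectic L lam),
        ∀ (ιA : (adelicGroupData (↥(maximalRealSubfield L)) L (IsCMField.complexConj L) 2 H).Adelic →*
            ↥(UnitaryGroup.adelic (↥(maximalRealSubfield L)) L (IsCMField.complexConj L) 2 (Matrix.diagonal dV))),
          (∀ k, ((ιA k : ↥(UnitaryGroup.adelic (↥(maximalRealSubfield L)) L (IsCMField.complexConj L) 2 (Matrix.diagonal dV))) :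
                GL (Fin 2) (AdeleRing (𝓞 L) L)) =
              (toAdeleGL L g)⁻¹ * adelicVal (↥(maximalRealSubfield L)) L (IsCMField.complexConj L) 2 H k * toAdeleGL L g) →
        ∀ [CompactSpace (↥(UnitaryGroup.adelic (↥(maximalRealSubfield L)) L (IsCMField.complexConj L) 2 (Matrix.diagonal dV)) ⧸
            (UnitaryGroup.toAdelic (↥(maximalRealSubfield L)) L (IsCMField.complexConj L) 2 (Matrix.diagonal dV)).range)],
        ∀ (P P₁ : DiscreteAutomorphicRep (adelicGroupData (↥(maximalRealSubfield L)) L (IsCMField.complexConj L) 2 H) μ) (a₁ : (↥(maximalRealSubfield L))ˣ),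
          P.IsHolCotangentAt₂ (IsCMField.complexConj_ne_one L) (UnitaryGroup.complexConj_smul_infinitePlace L) (cmPlace L ι) 𝔣 →
          ContRepresentation.AreUnitarilyEquivalent P.space.toContRep P₁.space.toContRep →
          MeetsThetaLiftFromLine L 2 H e₁ dV hdV hdV0 P₁ lam hlam a₁ ιA →
          ∀ τ' : L →+* ℂ, InfinitePlace.mk τ' ≠ InfinitePlace.mk ι →
            (exponentAt hlam.infinityType τ' = -1 ∧ (τ' (algebraMap (↥(maximalRealSubfield L)) L a₁ * (2 * imagUnit L)⁻¹)).im < 0) ∨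
              (exponentAt hlam.infinityType τ' = 1 ∧ 0 < (τ' (algebraMap (↥(maximalRealSubfield L)) L a₁ * (2 * imagUnit L)⁻¹)).im)) :
  ∀ (L : Type) [Field L] [NumberField L] [IsCMField L] (ι : L →+* ℂ) (H : Matrix (Fin 2) (Fin 2) L)
        (dV : Fin 2 → L) (hdV : ∀ i, IsCMField.complexConj L (dV i) = dV i) (hdV0 : ∀ i, dV i ≠ 0)
        (t : L) (ht : t ≠ 0) (g : GL (Fin 2) L)
        (hg : formCongr ((IsCMField.complexConj L : L ≃ₐ[↥(maximalRealSubfield L)] L) : L →+* L) g (t • H) = Matrix.diagonal dV),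
        (∃ T : GL (Fin 2) ℂ, formCongr (starRingEnd ℂ) T ((Matrix.diagonal dV).map ι) = Matrix.diagonal ![(1 : ℂ), -1]) →
        (∀ τ' : L →+* ℂ, InfinitePlace.mk τ' ≠ InfinitePlace.mk ι → ((Matrix.diagonal dV).map τ').PosDef) →
        4 ≤ Module.finrank ℚ L →
        ∀ (𝔣 : ConeFrame L H (cmPlace L ι))
          (μ : Measure (adelicGroupData (↥(maximalRealSubfield L)) L (IsCMField.complexConj L) 2 H).automorphicQuotient)
          [(adelicGroupData (↥(maximalRealSubfield L)) L (IsCMField.complexConj L) 2 H).IsAutomorphicMeasure μ]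
          {n' : ℕ} (e₁ : Fin 2 × Fin 1 ≃ Fin n')
          (lam : Literature.NumberTheory.Automorphic.IdeleClassGroup L →ₜ* Circle) (hlam : IsConjugateSymplectic L lam), HasWeight L lam 1 →
        ∀ (a : (↥(maximalRealSubfield L))ˣ) (χ : Chi (↥(maximalRealSubfield L)) L (IsCMField.complexConj L))
          (W : Type) [AddCommGroup W] [Module ℂ W]
          (σ : Representation ℂ (finAdelic (↥(maximalRealSubfield L)) L (IsCMField.complexConj L) 2 H) W),
          σ.IsIrreducible → σ.IsSmooth →
        ∀ j : σ.IntertwiningMap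
            ((rhoVAtLine (↥(maximalRealSubfield L)) L (IsCMField.complexConj L) 2 e₁ (Matrix.diagonal dV)
                (complexConj_imagUnit L) (imagUnit_ne_zero L) (imagUnit_mul_self L) (realDiagonal_isSymm L dV hdV)
                (isUnit_det_realDiagonal L dV hdV hdV0) (realDiagonal_map L dV hdV).symm
                (fun a => isCompatible_chiSplittingLine L e₁ dV hdV hdV0 (toHeckeCharacter L lam)
                  (isUnitary_toHeckeCharacter L lam) ((isOscillatorChar_toHeckeCharacter_iff lam).mpr hlam)
                  (TW (↥(maximalRealSubfield L)) a) (isSymm_TW (↥(maximalRealSubfield L)) a)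
                  (isUnit_det_TW (↥(maximalRealSubfield L)) a) (JW (↥(maximalRealSubfield L)) L a)
                  (JW_eq (↥(maximalRealSubfield L)) L a)) a χ).comp
              (finAdelicCongr (↥(maximalRealSubfield L)) L (IsCMField.complexConj L) g ht hg).symm.toMonoidHom),
          Function.Injective j →
        ∀ (ιA : (adelicGroupData (↥(maximalRealSubfield L)) L (IsCMField.complexConj L) 2 H).Adelic →*
            ↥(UnitaryGroup.adelic (↥(maximalRealSubfield L)) L (IsCMField.complexConj L) 2 (Matrix.diagonal dV))),
          (∀ k, ((ιA k : ↥(UnitaryGroup.adelic (↥(maximalRealSubfield L)) L (IsCMField.complexConj L) 2 (Matrix.diagonal dV))) :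
                GL (Fin 2) (AdeleRing (𝓞 L) L)) =
              (toAdeleGL L g)⁻¹ * adelicVal (↥(maximalRealSubfield L)) L (IsCMField.complexConj L) 2 H k * toAdeleGL L g) →
        ∀ [CompactSpace (↥(UnitaryGroup.adelic (↥(maximalRealSubfield L)) L (IsCMField.complexConj L) 2 (Matrix.diagonal dV)) ⧸
            (UnitaryGroup.toAdelic (↥(maximalRealSubfield L)) L (IsCMField.complexConj L) 2 (Matrix.diagonal dV)).range)],
        ∀ P : DiscreteAutomorphicRep (adelicGroupData (↥(maximalRealSubfield L)) L (IsCMField.complexConj L) 2 H) μ,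
          P.IsHolCotangentAt₂ (IsCMField.complexConj_ne_one L) (UnitaryGroup.complexConj_smul_infinitePlace L) (cmPlace L ι) 𝔣 →
          P.HasFinComponent σ →
        ∀ (a' b : (↥(maximalRealSubfield L))ˣ),
          letI : MeasurableSpace (↥(UnitaryGroup.adelic (↥(maximalRealSubfield L)) L (IsCMField.complexConj L) 1 (JW (↥(maximalRealSubfield L)) L a')) ⧸ (UnitaryGroup.toAdelic (↥(maximalRealSubfield L)) L (IsCMField.complexConj L) 1 (JW (↥(maximalRealSubfield L)) L a')).range) := borel _
          haveI := normal_range_toAdelic_JW L a'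
          letI : MeasurableSpace (↥(UnitaryGroup.adelic (↥(maximalRealSubfield L)) L (IsCMField.complexConj L) 1 (JW (↥(maximalRealSubfield L)) L b)) ⧸ (UnitaryGroup.toAdelic (↥(maximalRealSubfield L)) L (IsCMField.complexConj L) 1 (JW (↥(maximalRealSubfield L)) L b)).range) := borel _
          haveI := normal_range_toAdelic_JW L b
          ∀ (ξ' : PontryaginDual (↥(UnitaryGroup.adelic (↥(maximalRealSubfield L)) L (IsCMField.complexConj L) 1 (JW (↥(maximalRealSubfield L)) L a')) ⧸ (UnitaryGroup.toAdelic (↥(maximalRealSubfield L)) L (IsCMField.complexConj L) 1 (JW (↥(maximalRealSubfield L)) L a')).range))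
            (ξ'' : PontryaginDual (↥(UnitaryGroup.adelic (↥(maximalRealSubfield L)) L (IsCMField.complexConj L) 1 (JW (↥(maximalRealSubfield L)) L b)) ⧸ (UnitaryGroup.toAdelic (↥(maximalRealSubfield L)) L (IsCMField.complexConj L) 1 (JW (↥(maximalRealSubfield L)) L b)).range))
            (Q' Q'' : ContRepresentation.ClosedSubrep ((adelicGroupData (↥(maximalRealSubfield L)) L (IsCMField.complexConj L) 2 H).rightRegular μ)),
            (Q'.toSubmodule : Set ((adelicGroupData (↥(maximalRealSubfield L)) L (IsCMField.complexConj L) 2 H).L2 μ)) = closure (Submodule.span ℂ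
            {v : (adelicGroupData (↥(maximalRealSubfield L)) L (IsCMField.complexConj L) 2 H).L2 μ | ∃ (hρ : HasThetaMajorants fun
          (p : ↥(UnitaryGroup.adelic (↥(maximalRealSubfield L)) L (IsCMField.complexConj L) 2 (Matrix.diagonal dV)) × ↥(UnitaryGroup.adelic (↥(maximalRealSubfield L)) L (IsCMField.complexConj L) 1 (JW (↥(maximalRealSubfield L)) L a'))) (Φ : piSchwartzBruhat (↥(maximalRealSubfield L)) (Fin n')) =>
            pairRep (↥(maximalRealSubfield L)) L (IsCMField.complexConj L) 2 1 e₁ (Matrix.diagonal dV) (JW (↥(maximalRealSubfield L)) L a')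
              (chiSplittingLine L e₁ dV hdV hdV0 (toHeckeCharacter L lam) (isUnitary_toHeckeCharacter L lam)
                ((isOscillatorChar_toHeckeCharacter_iff lam).mpr hlam) (TW (↥(maximalRealSubfield L)) a')
                (isUnit_det_TW (↥(maximalRealSubfield L)) a') (JW (↥(maximalRealSubfield L)) L a') (JW_eq (↥(maximalRealSubfield L)) L a'))
              p Φ)
            (μW : Measure (↥(UnitaryGroup.adelic (↥(maximalRealSubfield L)) L (IsCMField.complexConj L) 1 (JW (↥(maximalRealSubfield L)) L a')) ⧸ (UnitaryGroup.toAdelic (↥(maximalRealSubfield L)) L (IsCMField.complexConj L) 1 (JW (↥(maximalRealSubfield L)) L a')).range)) (_ : IsFiniteMeasure μW)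
            (_ : SMulInvariantMeasure ↥(UnitaryGroup.adelic (↥(maximalRealSubfield L)) L (IsCMField.complexConj L) 1 (JW (↥(maximalRealSubfield L)) L a')) (↥(UnitaryGroup.adelic (↥(maximalRealSubfield L)) L (IsCMField.complexConj L) 1 (JW (↥(maximalRealSubfield L)) L a')) ⧸ (UnitaryGroup.toAdelic (↥(maximalRealSubfield L)) L (IsCMField.complexConj L) 1 (JW (↥(maximalRealSubfield L)) L a')).range) μW)
            (Ψ : piSchwartzBruhat (↥(maximalRealSubfield L)) (Fin n'))
            (hθ : MemLp (toQuotFun (adelicGroupData (↥(maximalRealSubfield L)) L (IsCMField.complexConj L) 2 H) fun x =>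
              (lineThetaKernelDatum L 2 e₁ dV hdV hdV0 lam hlam a' hρ).thetaLiftFun μW Ψ (charCM ξ') (ιA x)) 2 μ),
            v = MemLp.toLp _ hθ} : Set ((adelicGroupData (↥(maximalRealSubfield L)) L (IsCMField.complexConj L) 2 H).L2 μ)) →
            (Q''.toSubmodule : Set ((adelicGroupData (↥(maximalRealSubfield L)) L (IsCMField.complexConj L) 2 H).L2 μ)) = closure (Submodule.span ℂ
            {v : (adelicGroupData (↥(maximalRealSubfield L)) L (IsCMField.complexConj L) 2 H).L2 μ | ∃ (hρ : HasThetaMajorants fun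
          (p : ↥(UnitaryGroup.adelic (↥(maximalRealSubfield L)) L (IsCMField.complexConj L) 2 (Matrix.diagonal dV)) × ↥(UnitaryGroup.adelic (↥(maximalRealSubfield L)) L (IsCMField.complexConj L) 1 (JW (↥(maximalRealSubfield L)) L b))) (Φ : piSchwartzBruhat (↥(maximalRealSubfield L)) (Fin n')) =>
            pairRep (↥(maximalRealSubfield L)) L (IsCMField.complexConj L) 2 1 e₁ (Matrix.diagonal dV) (JW (↥(maximalRealSubfield L)) L b)
              (chiSplittingLine L e₁ dV hdV hdV0 (toHeckeCharacter L lam) (isUnitary_toHeckeCharacter L lam)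
                ((isOscillatorChar_toHeckeCharacter_iff lam).mpr hlam) (TW (↥(maximalRealSubfield L)) b)
                (isUnit_det_TW (↥(maximalRealSubfield L)) b) (JW (↥(maximalRealSubfield L)) L b) (JW_eq (↥(maximalRealSubfield L)) L b))
              p Φ)
            (μW : Measure (↥(UnitaryGroup.adelic (↥(maximalRealSubfield L)) L (IsCMField.complexConj L) 1 (JW (↥(maximalRealSubfield L)) L b)) ⧸ (UnitaryGroup.toAdelic (↥(maximalRealSubfield L)) L (IsCMField.complexConj L) 1 (JW (↥(maximalRealSubfield L)) L b)).range)) (_ : IsFiniteMeasure μW)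
            (_ : SMulInvariantMeasure ↥(UnitaryGroup.adelic (↥(maximalRealSubfield L)) L (IsCMField.complexConj L) 1 (JW (↥(maximalRealSubfield L)) L b)) (↥(UnitaryGroup.adelic (↥(maximalRealSubfield L)) L (IsCMField.complexConj L) 1 (JW (↥(maximalRealSubfield L)) L b)) ⧸ (UnitaryGroup.toAdelic (↥(maximalRealSubfield L)) L (IsCMField.complexConj L) 1 (JW (↥(maximalRealSubfield L)) L b)).range) μW)
            (Ψ : piSchwartzBruhat (↥(maximalRealSubfield L)) (Fin n'))
            (hθ : MemLp (toQuotFun (adelicGroupData (↥(maximalRealSubfield L)) L (IsCMField.complexConj L) 2 H) fun x =>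
              (lineThetaKernelDatum L 2 e₁ dV hdV hdV0 lam hlam b hρ).thetaLiftFun μW Ψ (charCM ξ'') (ιA x)) 2 μ),
            v = MemLp.toLp _ hθ} : Set ((adelicGroupData (↥(maximalRealSubfield L)) L (IsCMField.complexConj L) 2 H).L2 μ)) →
            Q'.toSubmodule ≠ ⊥ →
            ContRepresentation.AreUnitarilyEquivalent P.space.toContRep Q'.toContRep →
            ContRepresentation.AreUnitarilyEquivalent P.space.toContRep Q''.toContRep →
            (∀ v : HeightOneSpectrum (𝓞 (↥(maximalRealSubfield L))),
                locF (↥(maximalRealSubfield L)) (imagUnitSq L) a' v = locF (↥(maximalRealSubfield L)) (imagUnitSq L) b v) ∧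
              ∀ ρ : (↥(maximalRealSubfield L)) →+* ℝ, 0 < ρ ((a' : ↥(maximalRealSubfield L)) * ((b : ↥(maximalRealSubfield L)))⁻¹) := by
  intro L _ _ _ ι H dV hdV hdV0 t ht g hg hsig hdef h4 𝔣 μ _ n' e₁ lam hlam hw a χ W _ _ σ hirr hsm j hj ιA hιA _ P hP hPσ a' b
  letI : MeasurableSpace (↥(UnitaryGroup.adelic (↥(maximalRealSubfield L)) L (IsCMField.complexConj L) 1 (JW (↥(maximalRealSubfield L)) L a')) ⧸ (UnitaryGroup.toAdelic (↥(maximalRealSubfield L)) L (IsCMField.complexConj L) 1 (JW (↥(maximalRealSubfield L)) L a')).range) := borel _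
  haveI : BorelSpace (↥(UnitaryGroup.adelic (↥(maximalRealSubfield L)) L (IsCMField.complexConj L) 1 (JW (↥(maximalRealSubfield L)) L a')) ⧸ (UnitaryGroup.toAdelic (↥(maximalRealSubfield L)) L (IsCMField.complexConj L) 1 (JW (↥(maximalRealSubfield L)) L a')).range) := ⟨rfl⟩
  haveI := normal_range_toAdelic_JW L a'
  letI : MeasurableSpace (↥(UnitaryGroup.adelic (↥(maximalRealSubfield L)) L (IsCMField.complexConj L) 1 (JW (↥(maximalRealSubfield L)) L b)) ⧸ (UnitaryGroup.toAdelic (↥(maximalRealSubfield L)) L (IsCMField.complexConj L) 1 (JW (↥(maximalRealSubfield L)) L b)).range) := borel _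
  haveI : BorelSpace (↥(UnitaryGroup.adelic (↥(maximalRealSubfield L)) L (IsCMField.complexConj L) 1 (JW (↥(maximalRealSubfield L)) L b)) ⧸ (UnitaryGroup.toAdelic (↥(maximalRealSubfield L)) L (IsCMField.complexConj L) 1 (JW (↥(maximalRealSubfield L)) L b)).range) := ⟨rfl⟩
  haveI := normal_range_toAdelic_JW L b
  intro ξ' ξ'' Q' Q'' hQ' hQ'' hQ'ne hPQ' hPQ''
  -- 0. transport data, compactness, unitarity
  have hιA' : Continuous ιA ∧ ∀ ⦃γ : (adelicGroupData (↥(maximalRealSubfield L)) L (IsCMField.complexConj L) 2 H).Adelic⦄,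
      γ ∈ (UnitaryGroup.toAdelic (↥(maximalRealSubfield L)) L (IsCMField.complexConj L) 2 H).range →
        ιA γ ∈ (UnitaryGroup.toAdelic (↥(maximalRealSubfield L)) L (IsCMField.complexConj L) 2 (Matrix.diagonal dV)).range :=
    ⟨continuous_of_pin L 2 H dV g ιA hιA, fun _ hγ => mem_range_toAdelic_of_pin L 2 H dV t ht g hg ιA hιA hγ⟩
  have hιArat := Summit.HodgeConjecture.HodgeConjecture.Cruxes.HLiu418.F0P6LD1TransportRational.transport_toAdelic_mem_range L 2 H dV g ιA hιA
  haveI : CompactSpace (adelicGroupData (↥(maximalRealSubfield L)) L (IsCMField.complexConj L) 2 H).automorphicQuotient := by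
    obtain ⟨τ, hτ⟩ := UnitaryGroup.exists_infinitePlace_ne L h4 ι
    exact UnitaryGroup.compactSpace_adelicGroupData_automorphicQuotient L 2 H
      (UnitaryGroup.anisotropic_of_formCongr_smul_eq_of_posDef L 2 H dV t ht g hg τ (hdef τ hτ))
  have hR2 := (adelicGroupData (↥(maximalRealSubfield L)) L (IsCMField.complexConj L) 2 H).isUnitary_rightRegular μ
  -- 1. the spans are irreducible (they are `≃ᵤ P`) and non-zero
  obtain ⟨e', he'⟩ := hPQ'
  obtain ⟨e'', he''⟩ := hPQ''
  have hQ'irr : Q'.toContRep.IsTopIrreducible := (ContRepresentation.isTopIrreducible_congr e').1 P.irreducible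
  have hQ''irr : Q''.toContRep.IsTopIrreducible := (ContRepresentation.isTopIrreducible_congr e'').1 P.irreducible
  let P' : DiscreteAutomorphicRep (adelicGroupData (↥(maximalRealSubfield L)) L (IsCMField.complexConj L) 2 H) μ := ⟨Q', hQ'irr⟩
  let P'' : DiscreteAutomorphicRep (adelicGroupData (↥(maximalRealSubfield L)) L (IsCMField.complexConj L) 2 H) μ := ⟨Q'', hQ''irr⟩
  have hPQ' : ContRepresentation.AreUnitarilyEquivalent P.space.toContRep P'.space.toContRep := ⟨e', he'⟩
  have hPQ'' : ContRepresentation.AreUnitarilyEquivalent P.space.toContRep P''.space.toContRep := ⟨e'', he''⟩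
  have hQ''ne : Q''.toSubmodule ≠ ⊥ := by
    intro hbot
    obtain ⟨⟨v, hv⟩, hv0⟩ := @exists_ne _ P.nontrivial_space (0 : P.space.toSubmodule)
    have h1 : (e'' ⟨v, hv⟩ : Q''.toSubmodule) = 0 := by
      apply Subtype.ext
      exact (Submodule.mem_bot ℂ).1 (hbot ▸ (e'' ⟨v, hv⟩).2)
    exact hv0 (EquivLike.injective e'' (by rw [h1, map_zero]))
  -- 2. generators: a non-zero `(a′,ξ′)`-class IN `Q′`, a non-zero `(b,ξ″)`-class IN `Q″`; the spans MEET their own lines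
  obtain ⟨v', hv'S, hv'0⟩ := exists_mem_ne_zero_of_closure_span hQ' hQ'ne
  obtain ⟨hρ', μW', hfin', hinv', Ψ', hθ', rfl⟩ := hv'S
  have hmem' : MemLp.toLp _ hθ' ∈ Q'.toSubmodule := by
    rw [← SetLike.mem_coe, hQ']
    exact subset_closure (Submodule.subset_span ⟨hρ', μW', hfin', hinv', Ψ', hθ', rfl⟩)
  obtain ⟨v'', hv''S, hv''0⟩ := exists_mem_ne_zero_of_closure_span hQ'' hQ''ne
  obtain ⟨hρ'', μW'', hfin'', hinv'', Ψ'', hθ'', rfl⟩ := hv''S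
  have hmem'' : MemLp.toLp _ hθ'' ∈ Q''.toSubmodule := by
    rw [← SetLike.mem_coe, hQ'']
    exact subset_closure (Submodule.subset_span ⟨hρ'', μW'', hfin'', hinv'', Ψ'', hθ'', rfl⟩)
  haveI : IsFiniteMeasure μW' := hfin'
  haveI : IsFiniteMeasure μW'' := hfin''
  haveI : SMulInvariantMeasure ↥(UnitaryGroup.adelic (↥(maximalRealSubfield L)) L (IsCMField.complexConj L) 1 (JW (↥(maximalRealSubfield L)) L a'))
      (↥(UnitaryGroup.adelic (↥(maximalRealSubfield L)) L (IsCMField.complexConj L) 1 (JW (↥(maximalRealSubfield L)) L a')) ⧸ (UnitaryGroup.toAdelic (↥(maximalRealSubfield L)) L (IsCMField.complexConj L) 1 (JW (↥(maximalRealSubfield L)) L a')).range) μW' := hinv'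
  haveI : SMulInvariantMeasure ↥(UnitaryGroup.adelic (↥(maximalRealSubfield L)) L (IsCMField.complexConj L) 1 (JW (↥(maximalRealSubfield L)) L b))
      (↥(UnitaryGroup.adelic (↥(maximalRealSubfield L)) L (IsCMField.complexConj L) 1 (JW (↥(maximalRealSubfield L)) L b)) ⧸ (UnitaryGroup.toAdelic (↥(maximalRealSubfield L)) L (IsCMField.complexConj L) 1 (JW (↥(maximalRealSubfield L)) L b)).range) μW'' := hinv''
  have hmeets' : MeetsThetaLiftFromLine L 2 H e₁ dV hdV hdV0 P' lam hlam a' ιA :=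
    ⟨hρ', μW', hfin', hinv', charCM ξ', Ψ', hθ', hmem', hv'0⟩
  have hmeets'' : MeetsThetaLiftFromLine L 2 H e₁ dV hdV hdV0 P'' lam hlam b ιA :=
    ⟨hρ'', μW'', hfin'', hinv'', charCM ξ'', Ψ'', hθ'', hmem'', hv''0⟩
  -- 3. the central character `ψ` of `P` rides `≃ᵤ` (★ (T2)) and is trivial on the archimedean centre (hol test vector)
  obtain ⟨ψ, -, -, -, hψ⟩ := P.exists_centralCharacter_adelicCenter
  have hψ' := Summit.HodgeConjecture.HodgeConjecture.Cruxes.HLiu418.F0LD1UnitaryEquivTransport.centralCharacter_transport₂ L 2 H P P' hPQ' hψ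
  have hψ'' := Summit.HodgeConjecture.HodgeConjecture.Cruxes.HLiu418.F0LD1UnitaryEquivTransport.centralCharacter_transport₂ L 2 H P P'' hPQ'' hψ
  obtain ⟨fh, hfh, hfm, hfmem, hfne⟩ :=
    Summit.HodgeConjecture.HodgeConjecture.Cruxes.HLiu418.F0LD2CurveHolTestVector.exists_toLp_ne_zero_of_isHolCotangentAt₂ (μ := μ) P hP
  have hone : ∀ y : ↥(Literature.NumberTheory.Automorphic.relNormOneInfUnits (↥(maximalRealSubfield L)) L),
      ψ ((cmAdelicOneEquivRelNormOne L).symm (Literature.NumberTheory.Automorphic.relNormOneInfToIdeles (↥(maximalRealSubfield L)) L y)) = 1 := fun y =>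
    Summit.HodgeConjecture.HodgeConjecture.Cruxes.HLiu418.F0LD2CurveHolCotFormsArchCentre.centralCharacter_archCentre_eq_one₂
      (μ := μ) P hψ hfh hfm hfmem hfne y
  have harch' : ∀ (y : ↥(Literature.NumberTheory.Automorphic.relNormOneInfUnits (↥(maximalRealSubfield L)) L)) (v : P'.space.toSubmodule),
      P'.space.toContRep (adelicCenter (↥(maximalRealSubfield L)) L (IsCMField.complexConj L) 2 H
        ((cmAdelicOneEquivRelNormOne L).symm (Literature.NumberTheory.Automorphic.relNormOneInfToIdeles (↥(maximalRealSubfield L)) L y))) v = v := fun y v => by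
    rw [hψ' _ v, hone y, Units.val_one, one_smul]
  have harch'' : ∀ (y : ↥(Literature.NumberTheory.Automorphic.relNormOneInfUnits (↥(maximalRealSubfield L)) L)) (v : P''.space.toSubmodule),
      P''.space.toContRep (adelicCenter (↥(maximalRealSubfield L)) L (IsCMField.complexConj L) 2 H
        ((cmAdelicOneEquivRelNormOne L).symm (Literature.NumberTheory.Automorphic.relNormOneInfToIdeles (↥(maximalRealSubfield L)) L y))) v = v := fun y v => by
    rw [hψ'' _ v, hone y, Units.val_one, one_smul]
  -- 4. (δ) θ-type finite components of the spans, transferred to `P` (★ glue §1); ★ hSLC on `P` twice ⇒ equal finite line classes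
  obtain ⟨χ', hnt', hfc'⟩ :=
    Summit.HodgeConjecture.HodgeConjecture.Cruxes.HLiu418.F0LD2ThetaFinComponentOfArchCentre.thetaFinComponent₂_of_archCentre_fixed
      L ι H dV hdV hdV0 t ht g hg hdef h4 μ e₁ ιA hιA P' lam hlam a' hmeets' harch'
  obtain ⟨χ'', hnt'', hfc''⟩ :=
    Summit.HodgeConjecture.HodgeConjecture.Cruxes.HLiu418.F0LD2ThetaFinComponentOfArchCentre.thetaFinComponent₂_of_archCentre_fixed
      L ι H dV hdV hdV0 t ht g hg hdef h4 μ e₁ ιA hιA P'' lam hlam b hmeets'' harch''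
  have hfcP' := Summit.HodgeConjecture.HodgeConjecture.Cruxes.HLiu418.F0LD1MeetsOfOrthogonalCopy.hasFinComponent_of_equiv P' P e'.symm hfc'
  have hfcP'' := Summit.HodgeConjecture.HodgeConjecture.Cruxes.HLiu418.F0LD1MeetsOfOrthogonalCopy.hasFinComponent_of_equiv P'' P e''.symm hfc''
  have h₁ := Summit.HodgeConjecture.HodgeConjecture.Cruxes.HLiu418.F0LD2SameLabelClassesOfAFUCompact.sameLabelClasses₂_of_sameLabel hR
    L ι H dV hdV hdV0 t ht g hg hsig hdef h4 𝔣 μ e₁ lam hlam hw a χ W σ hirr hsm j hj P hP hPσ a' χ' hnt' hfcP'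
  have h₂ := Summit.HodgeConjecture.HodgeConjecture.Cruxes.HLiu418.F0LD2SameLabelClassesOfAFUCompact.sameLabelClasses₂_of_sameLabel hR
    L ι H dV hdV hdV0 t ht g hg hsig hdef h4 𝔣 μ e₁ lam hlam hw a χ W σ hirr hsm j hj P hP hPσ b χ'' hnt'' hfcP''
  have hfin : ∀ v : HeightOneSpectrum (𝓞 (↥(maximalRealSubfield L))),
      locF (↥(maximalRealSubfield L)) (imagUnitSq L) a' v = locF (↥(maximalRealSubfield L)) (imagUnitSq L) b v :=
    fun v => (h₁ v).trans (h₂ v).symm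
  -- 5. archimedean signs: at `ι` by ★ (β) from torus-covariant vectors pushed through `≃ᵤ` (★ (T1d)); away from `ι` by `hAwayU`
  have hcovP := Summit.HodgeConjecture.HodgeConjecture.Cruxes.HLiu418.F0LD2ArchSignOfTorusCovariant.torusCovariant_of_isHolCotangentAt₂
    L H dV hdV t ht g hg (cmPlace L ι) 𝔣 P hP
  have hcov' : ∀ 𝔣' : ConeFrame L H (cmPlace L ι), ∃ w ∈ P'.space.toSubmodule, w ≠ 0 ∧
      ∀ (γ : archLocal L 2 H (cmPlace L ι)) (q a : ℂ), q ≠ 0 →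
        ((γ : GL (Fin 2) ℂ) : Matrix (Fin 2) (Fin 2) ℂ) *ᵥ 𝔣'.v₀ = q • 𝔣'.v₀ →
        ((γ : GL (Fin 2) ℂ) : Matrix (Fin 2) (Fin 2) ℂ) *ᵥ 𝔣'.t₀ = a • 𝔣'.t₀ →
          (adelicGroupData (↥(maximalRealSubfield L)) L (IsCMField.complexConj L) 2 H).rightRegular μ
              (UnitaryGroup.adelicSingle (↥(maximalRealSubfield L)) L (IsCMField.complexConj L) 2 H (IsCMField.complexConj_ne_one L)
                (UnitaryGroup.complexConj_smul_infinitePlace L) (cmPlace L ι) γ) w = (a * q⁻¹) • w := fun 𝔣' => by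
    obtain ⟨w, hw, hw0, hlaw⟩ := hcovP 𝔣'
    obtain ⟨w₁, hw₁, hw₁0, hlaw₁⟩ :=
      Summit.HodgeConjecture.HodgeConjecture.Cruxes.HLiu418.F0LD1UnitaryEquivTransport.exists_mem_ne_zero_laws_of_areUnitarilyEquivalent hPQ'
        (fun i : archLocal L 2 H (cmPlace L ι) × ℂ × ℂ => i.2.1 ≠ 0 ∧
          ((i.1 : GL (Fin 2) ℂ) : Matrix (Fin 2) (Fin 2) ℂ) *ᵥ 𝔣'.v₀ = i.2.1 • 𝔣'.v₀ ∧
          ((i.1 : GL (Fin 2) ℂ) : Matrix (Fin 2) (Fin 2) ℂ) *ᵥ 𝔣'.t₀ = i.2.2 • 𝔣'.t₀)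
        (fun i => UnitaryGroup.adelicSingle (↥(maximalRealSubfield L)) L (IsCMField.complexConj L) 2 H (IsCMField.complexConj_ne_one L)
          (UnitaryGroup.complexConj_smul_infinitePlace L) (cmPlace L ι) i.1)
        (fun i => i.2.2 * i.2.1⁻¹)
        ⟨w, hw, hw0, fun i hi => hlaw i.1 i.2.1 i.2.2 hi.1 hi.2.1 hi.2.2⟩
    exact ⟨w₁, hw₁, hw₁0, fun γ q a hq h1 h2 => hlaw₁ ⟨γ, q, a⟩ ⟨hq, h1, h2⟩⟩
  have hcov'' : ∀ 𝔣' : ConeFrame L H (cmPlace L ι), ∃ w ∈ P''.space.toSubmodule, w ≠ 0 ∧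
      ∀ (γ : archLocal L 2 H (cmPlace L ι)) (q a : ℂ), q ≠ 0 →
        ((γ : GL (Fin 2) ℂ) : Matrix (Fin 2) (Fin 2) ℂ) *ᵥ 𝔣'.v₀ = q • 𝔣'.v₀ →
        ((γ : GL (Fin 2) ℂ) : Matrix (Fin 2) (Fin 2) ℂ) *ᵥ 𝔣'.t₀ = a • 𝔣'.t₀ →
          (adelicGroupData (↥(maximalRealSubfield L)) L (IsCMField.complexConj L) 2 H).rightRegular μ
              (UnitaryGroup.adelicSingle (↥(maximalRealSubfield L)) L (IsCMField.complexConj L) 2 H (IsCMField.complexConj_ne_one L)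
                (UnitaryGroup.complexConj_smul_infinitePlace L) (cmPlace L ι) γ) w = (a * q⁻¹) • w := fun 𝔣' => by
    obtain ⟨w, hw, hw0, hlaw⟩ := hcovP 𝔣'
    obtain ⟨w₁, hw₁, hw₁0, hlaw₁⟩ :=
      Summit.HodgeConjecture.HodgeConjecture.Cruxes.HLiu418.F0LD1UnitaryEquivTransport.exists_mem_ne_zero_laws_of_areUnitarilyEquivalent hPQ''
        (fun i : archLocal L 2 H (cmPlace L ι) × ℂ × ℂ => i.2.1 ≠ 0 ∧
          ((i.1 : GL (Fin 2) ℂ) : Matrix (Fin 2) (Fin 2) ℂ) *ᵥ 𝔣'.v₀ = i.2.1 • 𝔣'.v₀ ∧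
          ((i.1 : GL (Fin 2) ℂ) : Matrix (Fin 2) (Fin 2) ℂ) *ᵥ 𝔣'.t₀ = i.2.2 • 𝔣'.t₀)
        (fun i => UnitaryGroup.adelicSingle (↥(maximalRealSubfield L)) L (IsCMField.complexConj L) 2 H (IsCMField.complexConj_ne_one L)
          (UnitaryGroup.complexConj_smul_infinitePlace L) (cmPlace L ι) i.1)
        (fun i => i.2.2 * i.2.1⁻¹)
        ⟨w, hw, hw0, fun i hi => hlaw i.1 i.2.1 i.2.2 hi.1 hi.2.1 hi.2.2⟩
    exact ⟨w₁, hw₁, hw₁0, fun γ q a hq h1 h2 => hlaw₁ ⟨γ, q, a⟩ ⟨hq, h1, h2⟩⟩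
  have hι := Summit.HodgeConjecture.HodgeConjecture.Cruxes.HLiu418.F0LD2ArchSignOfTorusCovariant.im_mul_im_pos_of_meets_of_torusCovariant
    L ι H dV hdV hdV0 t ht g hg hsig hdef h4 𝔣 e₁ ιA hιA P' P'' lam hlam a' b hmeets' hmeets'' hcov' hcov''
  have haw' := hAwayU L ι H dV hdV hdV0 t ht g hg hsig hdef h4 𝔣 μ e₁ lam hlam ιA hιA P P' a' hP hPQ' hmeets'
  have haw'' := hAwayU L ι H dV hdV hdV0 t ht g hg hsig hdef h4 𝔣 μ e₁ lam hlam ιA hιA P P'' b hP hPQ'' hmeets''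
  have hpos : ∀ ρ : (↥(maximalRealSubfield L)) →+* ℝ, 0 < ρ ((a' : ↥(maximalRealSubfield L)) * ((b : ↥(maximalRealSubfield L)))⁻¹) := by
    intro ρ
    obtain ⟨w, hw⟩ := Summit.HodgeConjecture.HodgeConjecture.Cruxes.HLiu418.F0LD1RelativeArchPositivity.exists_place_over L ρ
    have hprod : 0 < (w.embedding (algebraMap (↥(maximalRealSubfield L)) L a' * (2 * imagUnit L)⁻¹)).im *
        (w.embedding (algebraMap (↥(maximalRealSubfield L)) L b * (2 * imagUnit L)⁻¹)).im := by
      by_cases hwι : w = InfinitePlace.mk ι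
      · have he : (cmPlace L ι).1 = w := hwι.symm
        rw [he] at hι
        exact hι
      · have hτ : InfinitePlace.mk w.embedding ≠ InfinitePlace.mk ι := by rw [NumberField.InfinitePlace.mk_embedding]; exact hwι
        rcases haw' w.embedding hτ with ⟨e1, s1⟩ | ⟨e1, s1⟩ <;> rcases haw'' w.embedding hτ with ⟨e2, s2⟩ | ⟨e2, s2⟩
        · exact mul_pos_of_neg_of_neg s1 s2
        · exfalso; rw [e1] at e2; norm_num at e2
        · exfalso; rw [e1] at e2; norm_num at e2
        · exact mul_pos s1 s2
    rw [Summit.HodgeConjecture.HodgeConjecture.Cruxes.HLiu418.F0LD1RelativeArchPositivity.im_embedding_algebraMap_mul L w.embedding ρ hw,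
      Summit.HodgeConjecture.HodgeConjecture.Cruxes.HLiu418.F0LD1RelativeArchPositivity.im_embedding_algebraMap_mul L w.embedding ρ hw] at hprod
    have hy : ρ (b : ↥(maximalRealSubfield L)) ≠ 0 := (map_ne_zero ρ).2 (Units.ne_zero b)
    rw [map_mul, map_inv₀]
    exact Summit.HodgeConjecture.HodgeConjecture.Cruxes.HLiu418.F0LD1RelativeArchPositivity.pos_mul_inv_of_mul_pos hy hprod
  exact ⟨hfin, hpos⟩

end Summit.HodgeConjecture.HodgeConjecture.Cruxes.HLiu418.F0LD1ThetaSpanLinePinOfBricks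

end
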